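import Summits.BirchSwinnertonDyer.BirchSwinnertonDyer.Theorems.ByReductionTypeAtTwoMultUpperHalfDefs
import Summits.BirchSwinnertonDyer.BirchSwinnertonDyer.Theorems.ByReductionTypeAtTwoMultUpperHalfIntegral
import Summits.BirchSwinnertonDyer.BirchSwinnertonDyer.Theorems.ByReductionTypeAtTwoMultUpperHalfCloses
import HarnessLib

/-!
# Route `ByReductionTypeAtTwo`, crux `MultUpperHalfAtTwo` (stmt-BirchSwinnertonDyer-19922): GLUE terms over the
# closed leaves of `ByReductionTypeAtTwoMultUpperHalfDefs.lean`

Two one-application certificates for the planner's layer-3 split of item 19922 (seat bsd-2adic-mult-2):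
the crux from {five PRINT facts, `GreenbergStevensAtSplitTwo`, `IntegralKatoAtOptimalMultTwo`}
(`Theorems.multUpperHalfAtTwo_of_integralKatoAtOptimal`, p420150) and from {`KatoRatAtMultTwo`, seven PRINT
facts, `GreenbergStevensAtSplitTwo`, `UpperHalfOffRoadAtMultTwo`}
(`Theorems.multUpperHalfAtTwo_of_optimalMuZero_of_offRoad`, p418902). The leaves unfold to the binders by `rfl`.
HONEST FRAMING (cell `bsd-2adic`): composition only; nothing asserted or booked. PARTITION: X5@2 mult (K4ᵐ,
B1·O1; 1 976) × p = 2 — types-the-object-of; closes none.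
-/

set_option autoImplicit false
set_option linter.dupNamespace false

noncomputable section

open WeierstrassCurve Literature.NumberTheory.EllipticCurves
  Literature.NumberTheory.EllipticCurves.ModularForms
  Literature.NumberTheory.EllipticCurves.Greenberg1999
  Summit.BirchSwinnertonDyer.BirchSwinnertonDyer.Theorems.MultUpperHalvesAtTwo

namespace Summit.BirchSwinnertonDyer.BirchSwinnertonDyer.Theorems

/-- **GLUE A (integral road):** PRINT {A235, A236, modularity, GZK, Cassels} → `GreenbergStevensAtSplitTwo` →
`IntegralKatoAtOptimalMultTwo` → `MultUpperHalfAtTwo` (one application of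
`multUpperHalfAtTwo_of_integralKatoAtOptimal`). [cite: Kato2004Asterisque, Thm. 17.4 (shape)]
[cite: Miller2011LMS, Def. 1.1] -/
theorem multUpperHalfAtTwo_of_leaves
    (h41ns : thm41Analogue_charValue_rankZero_numberField_anyPrime)
    (h41sp : thm41Analogue_charValue_rankZero_split_baseChange_anyPrime)
    (hmod : nonempty_modularParametrizationData)
    (hGZK : rank_eq_analyticRank_of_analyticRank_le_one)
    (hCassels : bsdRHS_eq_of_isIsogenous)
    (hGS : GreenbergStevensAtSplitTwo) (hK : IntegralKatoAtOptimalMultTwo) :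
    Summit.BirchSwinnertonDyer.BirchSwinnertonDyer.Theses.ByReductionTypeAtTwo.MultUpperHalfAtTwo :=
  multUpperHalfAtTwo_of_integralKatoAtOptimal h41ns h41sp hmod hGZK hCassels hGS hK

/-- **GLUE B (μ = 0 road + residual):** `KatoRatAtMultTwo` → PRINT {A235, A236, modularity, GZK, Cassels,
Prop 5.14@2, Česnavičius Thm 1.2} → `GreenbergStevensAtSplitTwo` → `UpperHalfOffRoadAtMultTwo` →
`MultUpperHalfAtTwo` (one application of `multUpperHalfAtTwo_of_optimalMuZero_of_offRoad`).
[cite: GreenbergLNM1716, Prop. 5.14 (shape)] [cite: Cesnavicius2018, Thm. 1.2] [cite: Miller2011LMS, Def. 1.1] -/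
theorem multUpperHalfAtTwo_of_leaves_offRoad (hKato : KatoRatAtMultTwo)
    (h41ns : thm41Analogue_charValue_rankZero_numberField_anyPrime)
    (h41sp : thm41Analogue_charValue_rankZero_split_baseChange_anyPrime)
    (hmod : nonempty_modularParametrizationData)
    (hGZK : rank_eq_analyticRank_of_analyticRank_le_one)
    (hCassels : bsdRHS_eq_of_isIsogenous)
    (h514 : prop514_isTorsion_mu_eq_zero_two)
    (hC : cesnavicius_not_two_dvd_maninConstant_of_two_dvd_level)
    (hGS : GreenbergStevensAtSplitTwo) (hoff : UpperHalfOffRoadAtMultTwo) :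
    Summit.BirchSwinnertonDyer.BirchSwinnertonDyer.Theses.ByReductionTypeAtTwo.MultUpperHalfAtTwo :=
  multUpperHalfAtTwo_of_optimalMuZero_of_offRoad hKato h41ns h41sp hmod hGZK hCassels h514 hC hGS hoff

end Summit.BirchSwinnertonDyer.BirchSwinnertonDyer.Theorems

end
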